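import Mathlib.RepresentationTheory.Homological.ContCohomology.Basic
import Literature.AnabelianGeometry.AbsoluteAnabelian.AbsTopISemiAbsolute

/-!
# [AbsTopI] Thm 2.6 (iii): the invariants `δʲ_l`, `εʲ_l`, `θʲ` and the statement `θ²(Π) ⊆ Σ`

S. Mochizuki, *Topics in Absolute Anabelian Geometry I: Generalities* (2012) [AbsTopI], Thm 2.6,
manuscript pp. 21–22 (lit key `paper:url-11ac98ba15fc`).  The preamble of Thm 2.6 (p. 21) defines,
for a profinite group `H`, `j ∈ {1, 2}` and a prime `l`,

  "`δʲ_l(H) := dim_{ℚ_l}(Hʲ(H, ℚ_l)) ∈ ℕ ∪ {∞}`,  `εʲ_l(Π) := sup_{J ⊆ Π} {δʲ_l(J)} ∈ ℕ ∪ {∞}`,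
   `θʲ(Π) := {l | εʲ_l(Π) ≥ 3 − j} ⊆ Primes`  [where `J` ranges over the open subgroups of `Π`]",

and item (iii) (p. 22) reads

  "(iii) Let `k` be as in (ii) [an MLF]. Then `θ²(Π) ⊆ Σ`. If, moreover, the cardinality of `θ¹(Π)`
   is `≥ 2`, then `θ²(Π) = Σ`."

abc-iut-L4-t4's `AbsTopISemiAbsolute.lean` typed Thm 2.6 (i), (ii), (iv), (v) [case `Θ = {1}`],
(vi) and Thm 2.14 over the interface `FundamentalExtension` but deliberately left (iii) out
(docstring there: "continuous cohomology with `ℚ_l`-coefficients is not available").  Mathlib now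
provides `continuousCohomology n (A : TopRep k G)` (homogeneous continuous cochains), so the
`H²`-invariants can be typed literally: this file adds the three invariants as real definitions and
item (iii) as the predicate `FundamentalExtension.Thm26iii S` (one decl per printed sub-item; no
proofs; nothing asserted); and — `θ²` being available — the GENERAL form of item (v) (the
subgroup `Θ ⊆ Π`, `ζ̃(Π) := ζ(Π/Θ)`, predicate `FundamentalExtension.Thm26vFull B`), of which
`AbsTopISemiAbsolute.Thm26v` typed the case `Θ = {1}` with a `TODO(general form)`.

Typing notes.  (1) `δʲ_l` is print-literal: the `ℚ_l`-dimension (as an element of `ℕ∞`, `⊤` when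
infinite) of the continuous cohomology of `H` with coefficients in the trivial representation on
`ℚ_l` (carried by `ULift ℚ_l` so that groups in any universe are allowed; the coefficient module is
`ℚ_l` up to the obvious isomorphism).  For `j = 1` and `H` topologically finitely generated profinite
this is classically the free pro-`l` rank `freeProlRank H l` in which the sibling predicates `Thm26i`,
`Thm26ii`, `Thm26v` are typed (`ProfiniteTerminology.lean` records that identification without
proof); (iii) is typed with the print-literal `θ¹`, `θ²`.  (2) `Σ` is the construction-data prime set,
a set of primes `S` as in `Thm26ii`/`Thm26iv`; "`θ²(Π) = Σ`" is typed against `{l ∈ S | l prime}` so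
that a stray non-prime in `S` cannot make the clause spuriously false.  (3) "the cardinality of
`θ¹(Π)` is `≥ 2`" is `2 ≤ Set.encard (θ¹(Π))`.
HONEST FRAMING: [AbsTopI] is a refereed, undisputed paper; typed ≠ proved; nothing here bears on
[IUTchIII] Cor. 3.12.
-/

noncomputable section

open CategoryTheory

namespace Literature.AnabelianGeometry.AbsoluteAnabelian

universe u

/-! ### The invariants `δʲ_l(H)`, `εʲ_l(Π)`, `θʲ(Π)` of [AbsTopI] Thm 2.6 -/

section Invariants

variable (G : Type u) [Group G] [TopologicalSpace G] [IsTopologicalGroup G]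

/-- [AbsTopI] Thm 2.6, preamble: `δʲ_l(H) := dim_{ℚ_l}(Hʲ(H, ℚ_l)) ∈ ℕ ∪ {∞}` for a profinite group
`H` — the `ℚ_l`-dimension, in `ℕ∞`, of the `j`-th continuous cohomology of `H` with coefficients in
`ℚ_l` with the trivial action (Mathlib's `continuousCohomology` of the trivial `TopRep`, coefficients
carried by `ULift ℚ_l`).  Typed for every topological group and every `j`.
[cite: MochizukiAbsTopI2012, Thm 2.6 p.21] -/
def deltaInv (j : ℕ) (l : ℕ) [Fact l.Prime] : ℕ∞ :=
  Cardinal.toENat (Module.rank ℚ_[l]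
    (continuousCohomology j (TopRep.of (ContRepresentation.trivial ℚ_[l] G (ULift.{u} ℚ_[l])))))

/-- [AbsTopI] Thm 2.6, preamble: `εʲ_l(Π) := sup_{J ⊆ Π} {δʲ_l(J)} ∈ ℕ ∪ {∞}`, "where `J` ranges over
the open subgroups of `Π`". [cite: MochizukiAbsTopI2012, Thm 2.6 p.21] -/
def epsilonInv (j : ℕ) (l : ℕ) [Fact l.Prime] : ℕ∞ :=
  ⨆ (J : Subgroup G) (_ : IsOpen (J : Set G)), deltaInv J j l

/-- [AbsTopI] Thm 2.6, preamble: `θʲ(Π) := {l | εʲ_l(Π) ≥ 3 − j} ⊆ Primes` (so `θ¹(Π)` is the set of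
primes `l` with `ε¹_l(Π) ≥ 2`, and `θ²(Π)` the set of primes `l` with `ε²_l(Π) ≥ 1`).
[cite: MochizukiAbsTopI2012, Thm 2.6 p.21] -/
def thetaSet (j : ℕ) : Set ℕ :=
  {l | ∃ hl : l.Prime, ((3 - j : ℕ) : ℕ∞) ≤ @epsilonInv G _ _ _ j l ⟨hl⟩}

/-! ### The subgroup `Θ ⊆ Π` and `ζ̃(Π) := ζ(Π/Θ)` of [AbsTopI] Thm 2.6 (v) -/

/-- The property quantified in [AbsTopI] Thm 2.6 (iv)/(v): `N ⊆ Π` is an "almost pro-omissive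
topologically finitely generated closed normal subgroup of `Π`" which is MAXIMAL among such
subgroups (a maximal element: no strictly larger such subgroup).
[cite: MochizukiAbsTopI2012, Thm 2.6 (v) p.22] -/
def IsMaximalAPONormal (N : Subgroup G) : Prop :=
  (N.Normal ∧ IsClosed (N : Set G) ∧ IsTopologicallyFinitelyGenerated N ∧ IsAlmostProOmissive N) ∧
    ∀ N' : Subgroup G, N'.Normal → IsClosed (N' : Set G) → IsTopologicallyFinitelyGenerated N' →
      IsAlmostProOmissive N' → N ≤ N' → N' = N

/-- [AbsTopI] Thm 2.6 (v): "If `θ²(Π) ≠ Primes`, then write `Θ ⊆ Π` for the maximal almost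
pro-omissive topologically finitely generated closed normal subgroup of `Π`, whenever a unique such
maximal subgroup exists; if `θ²(Π) = Primes`, or there does not exist a unique such maximal subgroup,
set `Θ := {1} ⊆ Π`."  (Classical case distinction; `θ² = thetaSet Π 2`.)
[cite: MochizukiAbsTopI2012, Thm 2.6 (v) p.22] -/
def thetaSubgroup : Subgroup G :=
  @dite (Subgroup G) (thetaSet G 2 ≠ {l | l.Prime} ∧ ∃! N : Subgroup G, IsMaximalAPONormal G N)
    (Classical.dec _) (fun h => Classical.choose h.2) (fun _ => ⊥)

/-- [AbsTopI] Thm 2.6 (v): `ζ̃(Π) := ζ(Π/Θ)` — the invariant `ζ` (`zetaInv`, built from the typed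
`δ¹ = freeProlRank`, as in `Thm26v`) of the topological quotient group `Π/Θ`.  (`Θ` is normal —
it is either the chosen maximal NORMAL subgroup or `{1}` — so it equals its normal core; the quotient
is formed by `Θ.normalCore` only so that the group structure on `Π/Θ` is found by instance, no proof
being allowed in this statements file.) [cite: MochizukiAbsTopI2012, Thm 2.6 (v) p.22] -/
def zetaTildeInv : ℕ∞ :=
  zetaInv (G ⧸ (thetaSubgroup G).normalCore)

end Invariants

/-! ### [AbsTopI] Thm 2.6 (iii) -/

namespace FundamentalExtension

variable (E : FundamentalExtension.{u})

/-- [AbsTopI] Thm 2.6 (iii) (`k` an MLF, i.e. base data `E.MLFBase` by name; construction data prime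
set `Σ = S`) as a predicate on an extension `1 → Δ → Π → G → 1`: "`θ²(Π) ⊆ Σ`. If, moreover, the
cardinality of `θ¹(Π)` is `≥ 2`, then `θ²(Π) = Σ`" — with `θʲ(Π) = thetaSet Π j` (print-literal,
via `H²(−, ℚ_l)` resp. `H¹(−, ℚ_l)`) and `Σ` read as the set of primes of `S`.
[cite: MochizukiAbsTopI2012, Thm 2.6 (iii) p.22] -/
def Thm26iii (S : Set ℕ) : Prop :=
  thetaSet E.arith 2 ⊆ {l ∈ S | l.Prime} ∧
    (2 ≤ (thetaSet E.arith 1).encard → thetaSet E.arith 2 = {l ∈ S | l.Prime})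

/-! ### [AbsTopI] Thm 2.6 (v), general form -/

/-- [AbsTopI] Thm 2.6 (v) (`k` an MLF of residue characteristic `p`, base data `B`), GENERAL form —
the `TODO(general form)` left at `Thm26v` (which types the case `Θ = {1}`, e.g. `Σ = Primes`):
"Then `ζ̃(Π) := ζ(Π/Θ) = [k : ℚ_p]` [cf. the finiteness portion of (ii)]. In particular, the kernel
of the quotient `Π ↠ G` may be characterized ["group-theoretically" — since "`θ²(−)`", "`ζ(−)`",
"`ζ̃(−)`" are "group-theoretic"] as the intersection of the open subgroups `H ⊆ Π` such that
`ζ̃(H)/ζ̃(Π) = [Π : H]`" — with `Θ = thetaSubgroup`, `ζ̃ = zetaTildeInv` (each open `H` carrying its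
own `Θ_H`, `θ²(H)`), the ratio typed multiplicatively as in `Thm26v`.  When `θ²(Π) = Primes`,
`Θ = {1}` and `ζ̃(Π) = ζ(Π/{1})`, which is `ζ(Π)` up to `Π/{1} ≅ Π` (not unfolded here).
[cite: MochizukiAbsTopI2012, Thm 2.6 (v) p.22] -/
def Thm26vFull (B : E.MLFBase) : Prop :=
  zetaTildeInv E.arith = (Module.finrank ℚ_[B.p] B.K : ℕ) ∧
    E.geom = ⨅ (H : Subgroup E.arith) (_ : IsOpen (H : Set E.arith))
      (_ : zetaTildeInv H = (H.index : ℕ∞) * zetaTildeInv E.arith), H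

end FundamentalExtension

end Literature.AnabelianGeometry.AbsoluteAnabelian
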